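import Literature.NumberTheory.Automorphic.ModularLambdaQExpansion
import Literature.Analysis.Complex.AnalyticFormalRoots
import HarnessLib

/-!
# Algebra of `q`-expansions of periodic holomorphic functions bounded at `i∞`

Topic `Literature/NumberTheory/ModularForms` (namespace
`Literature.NumberTheory.ModularForms.QExpansionAlgebra`). Everything here is PROVED (no
definitions, no named facts).

Mathlib's `UpperHalfPlane.qExpansion h f` is defined for every `f : ℍ → ℂ`, and its basic API
(`hasSum_qExpansion`, `qExpansion_mul`, …) is stated for functions which are `h`-periodic,
holomorphic and bounded at `i∞` — below "**nice** of period `h`", always spelled out as the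
conjunction `Periodic (f ∘ ofComplex) h ∧ MDiff f ∧ IsBoundedAtImInfty f`. This file collects the
closure properties of this class and the corresponding identities of `q`-expansions, which make
`f ↦ qExpansion h f` an injective ring homomorphism from nice functions to `ℂ⟦q⟧`:

* closure: `nice_mul`, `nice_pow`, `nice_add`, `nice_sub`, `nice_neg`, `nice_const`, `nice_smul`,
  `nice_sum`, `nice_polynomial_eval`; multiples of the period `nice_natMul`; the shift
  `nice_vadd_one`; functions of `𝕢`: `nice_comp_qParam`;
* expansions: `qExpansion_mul_of_nice`, `…_pow_…`, `…_add_…`, `…_sub_…`, `…_smul_…`,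
  `…_sum_…`, `qExpansion_const`, `qExpansion_polynomial_eval` (`= aeval`), the coefficients at a
  multiple of the period `qExpansion_natMul_coeff` (re-indexing `hasSum_smul_qParam_natMul`),
  the shift `qExpansion_vadd_one_coeff` (`aₙ ↦ e^{2πin/h} aₙ`), and `qExpansion_comp_qParam`
  (`qExpansion h (𝒴 ∘ 𝕢ₕ)` is the Taylor series of `𝒴`);
* injectivity `eq_of_qExpansion_eq`, rationality is inherited by multiples of the period
  (`qExpansion_natMul_coeff_mem_range`) and rational series are fixed by field automorphisms
  (`PowerSeries.map_eq_self_of_forall_coeff_ratCast`);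
* orders of vanishing: `exists_eq_qParam_pow_mul_of_coeff_eq_zero` (`f = 𝕢ₕᴺ g` with `g` nice
  when the first `N` coefficients vanish), `tendsto_atImInfty_of_nice` (the limit at `i∞` is the
  constant coefficient), `isBoundedAtImInfty_div_of_nice`.

Written for the analytic proof that Galois conjugates of (noncongruence) modular forms are
modular forms (Calegari–Dimitrov–Tang, *The unbounded denominators conjecture*, Remark 59).
[folklore]
-/

noncomputable section

open Complex Filter Topology Function Set Polynomial
open UpperHalfPlane hiding I
open scoped Real Topology Manifold Nat

namespace Literature.NumberTheory.ModularForms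

namespace QExpansionAlgebra

open Literature.NumberTheory.Automorphic.ModularLambda (qExpansion_coeff_eq_of_hasSum)

/-! ### Closure properties -/

/-- Products of nice functions are nice. [folklore] -/
theorem nice_mul {F G : ℍ → ℂ} {H : ℝ}
    (hF : Periodic (F ∘ ofComplex) H ∧ MDiff F ∧ IsBoundedAtImInfty F)
    (hG : Periodic (G ∘ ofComplex) H ∧ MDiff G ∧ IsBoundedAtImInfty G) :
    Periodic ((F * G) ∘ ofComplex) H ∧ MDiff (F * G) ∧ IsBoundedAtImInfty (F * G) :=
  ⟨by simpa only [Pi.mul_comp] using hF.1.mul hG.1, hF.2.1.mul hG.2.1, hF.2.2.mul hG.2.2⟩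

/-- Constant functions are nice. [folklore] -/
theorem nice_const (c : ℂ) (H : ℝ) :
    Periodic ((fun _ : ℍ ↦ c) ∘ ofComplex) H ∧ MDiff (fun _ : ℍ ↦ c) ∧
      IsBoundedAtImInfty (fun _ : ℍ ↦ c) :=
  ⟨fun _ ↦ rfl, mdifferentiable_const, Filter.const_boundedAtFilter _ _⟩

/-- Powers of nice functions are nice. [folklore] -/
theorem nice_pow {F : ℍ → ℂ} {H : ℝ}
    (hF : Periodic (F ∘ ofComplex) H ∧ MDiff F ∧ IsBoundedAtImInfty F) (n : ℕ) :
    Periodic ((F ^ n) ∘ ofComplex) H ∧ MDiff (F ^ n) ∧ IsBoundedAtImInfty (F ^ n) := by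
  induction n with
  | zero =>
    rw [pow_zero]
    exact ⟨fun _ ↦ rfl, mdifferentiable_const, Filter.const_boundedAtFilter _ _⟩
  | succ n ih => rw [pow_succ]; exact nice_mul ih hF

/-- Sums of nice functions are nice. [folklore] -/
theorem nice_add {F G : ℍ → ℂ} {H : ℝ}
    (hF : Periodic (F ∘ ofComplex) H ∧ MDiff F ∧ IsBoundedAtImInfty F)
    (hG : Periodic (G ∘ ofComplex) H ∧ MDiff G ∧ IsBoundedAtImInfty G) :
    Periodic ((F + G) ∘ ofComplex) H ∧ MDiff (F + G) ∧ IsBoundedAtImInfty (F + G) :=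
  ⟨by simpa only [Pi.add_comp] using hF.1.add hG.1, hF.2.1.add hG.2.1, hF.2.2.add hG.2.2⟩

/-- Negatives of nice functions are nice. [folklore] -/
theorem nice_neg {F : ℍ → ℂ} {H : ℝ}
    (hF : Periodic (F ∘ ofComplex) H ∧ MDiff F ∧ IsBoundedAtImInfty F) :
    Periodic ((-F) ∘ ofComplex) H ∧ MDiff (-F) ∧ IsBoundedAtImInfty (-F) := by
  have h : (-F) = (fun _ : ℍ ↦ (-1 : ℂ)) * F := by funext τ; simp
  rw [h]
  exact nice_mul (nice_const (-1) H) hF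

/-- Differences of nice functions are nice. [folklore] -/
theorem nice_sub {F G : ℍ → ℂ} {H : ℝ}
    (hF : Periodic (F ∘ ofComplex) H ∧ MDiff F ∧ IsBoundedAtImInfty F)
    (hG : Periodic (G ∘ ofComplex) H ∧ MDiff G ∧ IsBoundedAtImInfty G) :
    Periodic ((F - G) ∘ ofComplex) H ∧ MDiff (F - G) ∧ IsBoundedAtImInfty (F - G) := by
  rw [sub_eq_add_neg]
  exact nice_add hF (nice_neg hG)

/-- Constant multiples of nice functions are nice. [folklore] -/
theorem nice_smul {F : ℍ → ℂ} {H : ℝ} (c : ℂ)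
    (hF : Periodic (F ∘ ofComplex) H ∧ MDiff F ∧ IsBoundedAtImInfty F) :
    Periodic ((c • F) ∘ ofComplex) H ∧ MDiff (c • F) ∧ IsBoundedAtImInfty (c • F) := by
  have h : c • F = (fun _ : ℍ ↦ c) * F := by funext τ; simp
  rw [h]
  exact nice_mul (nice_const c H) hF

/-- The zero function is nice. [folklore] -/
theorem nice_zero (H : ℝ) :
    Periodic ((0 : ℍ → ℂ) ∘ ofComplex) H ∧ MDiff (0 : ℍ → ℂ) ∧ IsBoundedAtImInfty (0 : ℍ → ℂ) :=
  nice_const 0 H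

/-- Finite sums of nice functions are nice. [folklore] -/
theorem nice_sum {ι : Type*} (s : Finset ι) {F : ι → ℍ → ℂ} {H : ℝ}
    (hF : ∀ i ∈ s, Periodic (F i ∘ ofComplex) H ∧ MDiff (F i) ∧ IsBoundedAtImInfty (F i)) :
    Periodic ((∑ i ∈ s, F i) ∘ ofComplex) H ∧ MDiff (∑ i ∈ s, F i) ∧
      IsBoundedAtImInfty (∑ i ∈ s, F i) := by
  classical
  induction s using Finset.induction_on with
  | empty => simpa using nice_zero H
  | insert a s ha ih =>
    rw [Finset.sum_insert ha]
    exact nice_add (hF a (Finset.mem_insert_self a s))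
      (ih fun i hi ↦ hF i (Finset.mem_insert_of_mem hi))

/-- Polynomials in a nice function are nice. [folklore] -/
theorem nice_polynomial_eval {F : ℍ → ℂ} {H : ℝ} (p : ℂ[X])
    (hF : Periodic (F ∘ ofComplex) H ∧ MDiff F ∧ IsBoundedAtImInfty F) :
    Periodic ((fun τ ↦ p.eval (F τ)) ∘ ofComplex) H ∧ MDiff (fun τ ↦ p.eval (F τ)) ∧
      IsBoundedAtImInfty (fun τ ↦ p.eval (F τ)) := by
  have h : (fun τ ↦ p.eval (F τ)) = ∑ n ∈ Finset.range (p.natDegree + 1), (p.coeff n • F ^ n) := by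
    funext τ
    rw [Polynomial.eval_eq_sum_range]
    simp [Finset.sum_apply]
  rw [h]
  exact nice_sum _ fun n _ ↦ nice_smul _ (nice_pow hF n)

/-! ### `q`-expansions of products, powers, sums -/

/-- `qExpansion` is multiplicative on nice functions. [folklore] -/
theorem qExpansion_mul_of_nice {F G : ℍ → ℂ} {H : ℝ} (hH : 0 < H)
    (hF : Periodic (F ∘ ofComplex) H ∧ MDiff F ∧ IsBoundedAtImInfty F)
    (hG : Periodic (G ∘ ofComplex) H ∧ MDiff G ∧ IsBoundedAtImInfty G) :
    qExpansion H (F * G) = qExpansion H F * qExpansion H G :=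
  qExpansion_mul (analyticAt_cuspFunction_zero hH hF.1 hF.2.1 hF.2.2)
    (analyticAt_cuspFunction_zero hH hG.1 hG.2.1 hG.2.2)

/-- `qExpansion` of powers of nice functions. [folklore] -/
theorem qExpansion_pow_of_nice {F : ℍ → ℂ} {H : ℝ} (hH : 0 < H)
    (hF : Periodic (F ∘ ofComplex) H ∧ MDiff F ∧ IsBoundedAtImInfty F) (n : ℕ) :
    qExpansion H (F ^ n) = qExpansion H F ^ n := by
  induction n with
  | zero => rw [pow_zero, pow_zero, qExpansion_one]
  | succ n ih => rw [pow_succ, pow_succ, qExpansion_mul_of_nice hH (nice_pow hF n) hF, ih]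

/-- `qExpansion` is additive on nice functions. [folklore] -/
theorem qExpansion_add_of_nice {F G : ℍ → ℂ} {H : ℝ} (hH : 0 < H)
    (hF : Periodic (F ∘ ofComplex) H ∧ MDiff F ∧ IsBoundedAtImInfty F)
    (hG : Periodic (G ∘ ofComplex) H ∧ MDiff G ∧ IsBoundedAtImInfty G) :
    qExpansion H (F + G) = qExpansion H F + qExpansion H G :=
  qExpansion_add (analyticAt_cuspFunction_zero hH hF.1 hF.2.1 hF.2.2)
    (analyticAt_cuspFunction_zero hH hG.1 hG.2.1 hG.2.2)

/-- `qExpansion` of a difference of nice functions. [folklore] -/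
theorem qExpansion_sub_of_nice {F G : ℍ → ℂ} {H : ℝ} (hH : 0 < H)
    (hF : Periodic (F ∘ ofComplex) H ∧ MDiff F ∧ IsBoundedAtImInfty F)
    (hG : Periodic (G ∘ ofComplex) H ∧ MDiff G ∧ IsBoundedAtImInfty G) :
    qExpansion H (F - G) = qExpansion H F - qExpansion H G :=
  qExpansion_sub (analyticAt_cuspFunction_zero hH hF.1 hF.2.1 hF.2.2)
    (analyticAt_cuspFunction_zero hH hG.1 hG.2.1 hG.2.2)

/-- `qExpansion` of a constant multiple of a nice function. [folklore] -/
theorem qExpansion_smul_of_nice {F : ℍ → ℂ} {H : ℝ} (hH : 0 < H) (c : ℂ)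
    (hF : Periodic (F ∘ ofComplex) H ∧ MDiff F ∧ IsBoundedAtImInfty F) :
    qExpansion H (c • F) = c • qExpansion H F :=
  qExpansion_smul (analyticAt_cuspFunction_zero hH hF.1 hF.2.1 hF.2.2) c

/-- `qExpansion` of a finite sum of nice functions. [folklore] -/
theorem qExpansion_sum_of_nice {ι : Type*} (s : Finset ι) {F : ι → ℍ → ℂ} {H : ℝ} (hH : 0 < H)
    (hF : ∀ i ∈ s, Periodic (F i ∘ ofComplex) H ∧ MDiff (F i) ∧ IsBoundedAtImInfty (F i)) :
    qExpansion H (∑ i ∈ s, F i) = ∑ i ∈ s, qExpansion H (F i) := by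
  classical
  induction s using Finset.induction_on with
  | empty => simp [qExpansion_zero]
  | insert a s ha ih =>
    rw [Finset.sum_insert ha, Finset.sum_insert ha,
      qExpansion_add_of_nice hH (hF a (Finset.mem_insert_self a s))
        (nice_sum s fun i hi ↦ hF i (Finset.mem_insert_of_mem hi)),
      ih fun i hi ↦ hF i (Finset.mem_insert_of_mem hi)]

/-- `qExpansion` of a constant function is the constant power series. [folklore] -/
theorem qExpansion_const (c : ℂ) {H : ℝ} (hH : 0 < H) :
    qExpansion H (fun _ : ℍ ↦ c) = PowerSeries.C c := by
  have hn := nice_const c H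
  have han := analyticAt_cuspFunction_zero hH hn.1 hn.2.1 hn.2.2
  have key : ∀ m, (qExpansion H (fun _ : ℍ ↦ c)).coeff m = (if m = 0 then c else 0) := by
    refine qExpansion_coeff_eq_of_hasSum hH han fun τ ↦ ?_
    convert hasSum_ite_eq 0 c using 1
    funext m
    split_ifs with h
    · simp [h]
    · simp
  ext m
  rw [key m, PowerSeries.coeff_C]

/-- **`qExpansion` of a polynomial in a nice function is the polynomial in the expansion.**
[folklore] -/
theorem qExpansion_polynomial_eval {F : ℍ → ℂ} {H : ℝ} (hH : 0 < H) (p : ℂ[X])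
    (hF : Periodic (F ∘ ofComplex) H ∧ MDiff F ∧ IsBoundedAtImInfty F) :
    qExpansion H (fun τ ↦ p.eval (F τ)) = Polynomial.aeval (qExpansion H F) p := by
  have h : (fun τ ↦ p.eval (F τ)) = ∑ n ∈ Finset.range (p.natDegree + 1), (p.coeff n • F ^ n) := by
    funext τ
    rw [Polynomial.eval_eq_sum_range]
    simp [Finset.sum_apply]
  rw [h, qExpansion_sum_of_nice _ hH (fun n _ ↦ nice_smul _ (nice_pow hF n)),
    Polynomial.aeval_eq_sum_range]
  refine Finset.sum_congr rfl fun n _ ↦ ?_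
  rw [qExpansion_smul_of_nice hH _ (nice_pow hF n), qExpansion_pow_of_nice hH hF]

/-! ### Injectivity -/

/-- **Nice functions with the same `q`-expansion are equal.** [folklore] -/
theorem eq_of_qExpansion_eq {F G : ℍ → ℂ} {H : ℝ} (hH : 0 < H)
    (hF : Periodic (F ∘ ofComplex) H ∧ MDiff F ∧ IsBoundedAtImInfty F)
    (hG : Periodic (G ∘ ofComplex) H ∧ MDiff G ∧ IsBoundedAtImInfty G)
    (h : qExpansion H F = qExpansion H G) : F = G := by
  funext τ
  have h1 := hasSum_qExpansion hH hF.1 hF.2.1 hF.2.2 τ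
  have h2 := hasSum_qExpansion hH hG.1 hG.2.1 hG.2.2 τ
  rw [h] at h1
  exact h1.unique h2

/-! ### Multiples of the period -/

/-- `𝕢_{nH}(τ)ⁿ = 𝕢_H(τ)`. [folklore] -/
theorem qParam_natMul_pow {n : ℕ} (hn : n ≠ 0) (H : ℝ) (τ : ℂ) :
    Periodic.qParam (n * H) τ ^ n = Periodic.qParam H τ := by
  simp only [Periodic.qParam, ← Complex.exp_nat_mul]
  congr 1
  push_cast
  rw [mul_div_assoc', mul_div_mul_left _ _ (Nat.cast_ne_zero.mpr hn)]

/-- **Re-indexing a `q`-series to a multiple of the period.** If `Σₘ aₘ 𝕢_H(τ)ᵐ = s` then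
`Σₘ a'ₘ 𝕢_{nH}(τ)ᵐ = s` with `a'ₘ = a_{m/n}` for `n ∣ m` and `a'ₘ = 0` otherwise. [folklore] -/
theorem hasSum_smul_qParam_natMul {a : ℕ → ℂ} {s : ℂ} {H : ℝ} {n : ℕ} (hn : n ≠ 0) {τ : ℂ}
    (h : HasSum (fun m ↦ a m • Periodic.qParam H τ ^ m) s) :
    HasSum (fun m ↦ (if n ∣ m then a (m / n) else 0) • Periodic.qParam (n * H) τ ^ m) s := by
  have hinj : Injective (fun m : ℕ ↦ n * m) := mul_right_injective₀ hn
  rw [← hasSum_extend_zero hinj] at h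
  convert h using 1
  funext m
  by_cases hm : n ∣ m
  · obtain ⟨m', rfl⟩ := hm
    rw [hinj.extend_apply, if_pos (dvd_mul_right n m'),
      Nat.mul_div_cancel_left _ (Nat.pos_of_ne_zero hn), pow_mul, qParam_natMul_pow hn]
  · rw [if_neg hm, zero_smul, extend_apply' _ _ _ fun ⟨m', hm'⟩ ↦ hm ⟨m', hm'.symm⟩,
      Pi.zero_apply]

/-- A nice function of period `H` is nice of period `nH`. [folklore] -/
theorem nice_natMul {F : ℍ → ℂ} {H : ℝ} (n : ℕ)
    (hF : Periodic (F ∘ ofComplex) H ∧ MDiff F ∧ IsBoundedAtImInfty F) :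
    Periodic (F ∘ ofComplex) (((n : ℝ) * H : ℝ) : ℂ) ∧ MDiff F ∧ IsBoundedAtImInfty F :=
  ⟨by simpa only [ofReal_mul, ofReal_natCast] using hF.1.nat_mul n, hF.2.1, hF.2.2⟩

/-- **Coefficients at a multiple of the period.** If `F` is nice of period `H` and `H' = nH`,
then the `m`-th coefficient of `qExpansion H' F` is the `m/n`-th coefficient of `qExpansion H F`
for `n ∣ m` and `0` otherwise. [folklore] -/
theorem qExpansion_natMul_coeff {F : ℍ → ℂ} {H H' : ℝ} {n : ℕ} (hn : n ≠ 0) (hHH' : H' = n * H)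
    (hH : 0 < H) (hF : Periodic (F ∘ ofComplex) H ∧ MDiff F ∧ IsBoundedAtImInfty F) (m : ℕ) :
    (qExpansion H' F).coeff m = if n ∣ m then (qExpansion H F).coeff (m / n) else 0 := by
  subst hHH'
  have hnH : 0 < (n : ℝ) * H := mul_pos (Nat.cast_pos.mpr (Nat.pos_of_ne_zero hn)) hH
  have hF' := nice_natMul n hF
  have han := analyticAt_cuspFunction_zero hnH hF'.1 hF'.2.1 hF'.2.2
  have hs : ∀ τ : ℍ, HasSum (fun k ↦ (if n ∣ k then (qExpansion H F).coeff (k / n) else 0) •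
      Periodic.qParam (n * H) τ ^ k) (F τ) := fun τ ↦
    hasSum_smul_qParam_natMul (a := fun k ↦ (qExpansion H F).coeff k) (s := F τ) (H := H)
      (τ := (τ : ℂ)) hn (hasSum_qExpansion hH hF.1 hF.2.1 hF.2.2 τ)
  exact qExpansion_coeff_eq_of_hasSum
    (c := fun k ↦ if n ∣ k then (qExpansion H F).coeff (k / n) else 0) hnH han hs m

/-- Rationality of the coefficients is inherited by multiples of the period. [folklore] -/
theorem qExpansion_natMul_coeff_mem_range {F : ℍ → ℂ} {H H' : ℝ} {n : ℕ} (hn : n ≠ 0)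
    (hHH' : H' = n * H) (hH : 0 < H)
    (hF : Periodic (F ∘ ofComplex) H ∧ MDiff F ∧ IsBoundedAtImInfty F)
    (hrat : ∀ m, (qExpansion H F).coeff m ∈ Set.range ((↑) : ℚ → ℂ)) (m : ℕ) :
    (qExpansion H' F).coeff m ∈ Set.range ((↑) : ℚ → ℂ) := by
  rw [qExpansion_natMul_coeff hn hHH' hH hF]
  split_ifs
  · exact hrat _
  · exact ⟨0, by simp⟩

/-- A power series with rational coefficients is fixed by every ring endomorphism of `ℂ`.
[folklore] -/
theorem _root_.PowerSeries.map_eq_self_of_forall_coeff_ratCast (σ : ℂ →+* ℂ)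
    {ψ : PowerSeries ℂ} (h : ∀ m, ψ.coeff m ∈ Set.range ((↑) : ℚ → ℂ)) :
    PowerSeries.map σ ψ = ψ := by
  ext m
  obtain ⟨q, hq⟩ := h m
  rw [PowerSeries.coeff_map, ← hq, map_ratCast]

/-! ### The shift `τ ↦ τ + 1` -/

/-- `𝕢_H(τ + 1) = e^{2πi/H} 𝕢_H(τ)`. [folklore] -/
theorem qParam_add_one (H : ℝ) (τ : ℂ) :
    Periodic.qParam H (τ + 1) = cexp (2 * π * Complex.I / H) * Periodic.qParam H τ := by
  simp only [Periodic.qParam, ← Complex.exp_add]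
  congr 1
  ring

/-- The shift of a nice function is nice. [folklore] -/
theorem nice_vadd_one {F : ℍ → ℂ} {H : ℝ}
    (hF : Periodic (F ∘ ofComplex) H ∧ MDiff F ∧ IsBoundedAtImInfty F) :
    Periodic ((fun τ : ℍ ↦ F ((1 : ℝ) +ᵥ τ)) ∘ ofComplex) H ∧ MDiff (fun τ : ℍ ↦ F ((1 : ℝ) +ᵥ τ)) ∧
      IsBoundedAtImInfty (fun τ : ℍ ↦ F ((1 : ℝ) +ᵥ τ)) := by
  refine ⟨?_, ?_, ?_⟩
  · intro w
    simp only [comp_apply]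
    by_cases hw : 0 < w.im
    · have hw' : 0 < (w + H).im := by simpa using hw
      have h1 : (1 : ℝ) +ᵥ ofComplex (w + H) = ofComplex ((w + 1) + H) := by
        apply UpperHalfPlane.ext
        rw [coe_vadd, ofComplex_apply_of_im_pos hw', ofComplex_apply_of_im_pos (by simpa using hw)]
        push_cast; ring
      have h2 : (1 : ℝ) +ᵥ ofComplex w = ofComplex (w + 1) := by
        apply UpperHalfPlane.ext
        rw [coe_vadd, ofComplex_apply_of_im_pos hw, ofComplex_apply_of_im_pos (by simpa using hw)]
        push_cast; ring
      rw [h1, h2]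
      exact hF.1 (w + 1)
    · have hw0 : w.im ≤ 0 := not_lt.mp hw
      have hw' : (w + H).im ≤ 0 := by simpa using hw0
      rw [ofComplex_apply_of_im_nonpos hw', ofComplex_apply_of_im_nonpos hw0]
  · intro τ
    have h := (hF.2.1 ((1 : ℝ) +ᵥ τ))
    rw [UpperHalfPlane.mdifferentiableAt_iff] at h ⊢
    set G : ℂ → ℂ := F ∘ ofComplex with hGdef
    have hd : DifferentiableAt ℂ (fun z : ℂ ↦ G (z + 1)) τ := by
      have : (((1 : ℝ) +ᵥ τ : ℍ) : ℂ) = (τ : ℂ) + 1 := by rw [coe_vadd]; push_cast; ring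
      rw [this] at h
      exact DifferentiableAt.comp (g := G) (f := fun z : ℂ ↦ z + 1) (τ : ℂ) h
        (differentiableAt_id.add_const (1 : ℂ))
    refine hd.congr_of_eventuallyEq ?_
    filter_upwards [(isOpen_lt continuous_const Complex.continuous_im).mem_nhds τ.im_pos] with z hz
    simp only [comp_apply, hGdef]
    congr 1
    apply UpperHalfPlane.ext
    rw [coe_vadd, ofComplex_apply_of_im_pos hz, ofComplex_apply_of_im_pos (by simpa using hz)]
    push_cast; ring
  · have ht : Tendsto (fun τ : ℍ ↦ (1 : ℝ) +ᵥ τ) atImInfty atImInfty := by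
      rw [atImInfty, tendsto_comap_iff]
      have : UpperHalfPlane.im ∘ (fun τ : ℍ ↦ (1 : ℝ) +ᵥ τ) = UpperHalfPlane.im := by
        funext τ
        simp [vadd_im]
      rw [this]
      exact tendsto_comap
    exact hF.2.2.comp_tendsto ht

/-- **`q`-expansion of the shift**: the `n`-th coefficient of `τ ↦ F(τ + 1)` is
`e^{2πin/H}` times that of `F`. [folklore] -/
theorem qExpansion_vadd_one_coeff {F : ℍ → ℂ} {H : ℝ} (hH : 0 < H)
    (hF : Periodic (F ∘ ofComplex) H ∧ MDiff F ∧ IsBoundedAtImInfty F) (n : ℕ) :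
    (qExpansion H (fun τ : ℍ ↦ F ((1 : ℝ) +ᵥ τ))).coeff n =
      cexp (2 * π * Complex.I / H) ^ n * (qExpansion H F).coeff n := by
  have hF' := nice_vadd_one hF
  refine qExpansion_coeff_eq_of_hasSum
    (c := fun m ↦ cexp (2 * π * Complex.I / H) ^ m * (qExpansion H F).coeff m) hH
    (analyticAt_cuspFunction_zero hH hF'.1 hF'.2.1 hF'.2.2) (fun τ ↦ ?_) n
  have h := hasSum_qExpansion hH hF.1 hF.2.1 hF.2.2 ((1 : ℝ) +ᵥ τ)
  have hq : Periodic.qParam H (((1 : ℝ) +ᵥ τ : ℍ) : ℂ) =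
      cexp (2 * π * Complex.I / H) * Periodic.qParam H τ := by
    rw [coe_vadd, show ((1 : ℝ) : ℂ) + (τ : ℂ) = (τ : ℂ) + 1 by push_cast; ring, qParam_add_one]
  rw [hq] at h
  convert h using 2 with m
  rw [mul_pow, smul_eq_mul, smul_eq_mul]
  ring

/-! ### Functions of `𝕢` and the Taylor series of the cusp function -/

/-- **A holomorphic function of `𝕢_H` is nice**, and its `q`-expansion is the Taylor series of
the function: if `𝒴` is holomorphic on the unit disc then `τ ↦ 𝒴(𝕢_H τ)` is nice of period `H`
and `qExpansion H (𝒴 ∘ 𝕢_H) = Σ (𝒴⁽ⁿ⁾(0)/n!) qⁿ`. [folklore] -/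
theorem nice_comp_qParam {𝒴 : ℂ → ℂ} (h𝒴 : DifferentiableOn ℂ 𝒴 (Metric.ball 0 1)) {H : ℝ}
    (hH : 0 < H) :
    (Periodic ((fun τ : ℍ ↦ 𝒴 (Periodic.qParam H τ)) ∘ ofComplex) H ∧
      MDiff (fun τ : ℍ ↦ 𝒴 (Periodic.qParam H τ)) ∧
      IsBoundedAtImInfty (fun τ : ℍ ↦ 𝒴 (Periodic.qParam H τ))) ∧
    (∀ z ∈ Metric.ball (0 : ℂ) 1, cuspFunction H (fun τ : ℍ ↦ 𝒴 (Periodic.qParam H τ)) z = 𝒴 z) ∧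
    qExpansion H (fun τ : ℍ ↦ 𝒴 (Periodic.qParam H τ)) =
      PowerSeries.mk fun n ↦ ((n ! : ℂ))⁻¹ * iteratedDeriv n 𝒴 0 := by
  set F : ℍ → ℂ := fun τ ↦ 𝒴 (Periodic.qParam H τ) with hFdef
  have hper : Periodic (F ∘ ofComplex) H := by
    intro w
    simp only [comp_apply, hFdef]
    by_cases hw : 0 < w.im
    · have hw' : 0 < (w + H).im := by simpa using hw
      have hq : Periodic.qParam H (w + H) = Periodic.qParam H w := by
        simp only [Periodic.qParam]
        rw [mul_add, add_div, mul_div_cancel_right₀ _ (ofReal_ne_zero.mpr hH.ne'), Complex.exp_add,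
          Complex.exp_two_pi_mul_I, mul_one]
      rw [ofComplex_apply_of_im_pos hw', ofComplex_apply_of_im_pos hw, hq]
    · have hw0 : w.im ≤ 0 := not_lt.mp hw
      have hw' : (w + H).im ≤ 0 := by simpa using hw0
      rw [ofComplex_apply_of_im_nonpos hw', ofComplex_apply_of_im_nonpos hw0]
  have hmd : MDiff F := by
    intro τ
    rw [UpperHalfPlane.mdifferentiableAt_iff]
    have hq : ‖Periodic.qParam H (τ : ℂ)‖ < 1 := Periodic.norm_qParam_lt_one hH τ.im_pos
    have h1 : DifferentiableAt ℂ (fun z : ℂ ↦ 𝒴 (Periodic.qParam H z)) τ := by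
      exact (h𝒴.differentiableAt (Metric.isOpen_ball.mem_nhds (mem_ball_zero_iff.mpr hq))).comp
        (τ : ℂ) (Periodic.differentiable_qParam (τ : ℂ))
    refine h1.congr_of_eventuallyEq ?_
    filter_upwards [(isOpen_lt continuous_const Complex.continuous_im).mem_nhds τ.im_pos] with z hz
    simp only [comp_apply, hFdef, ofComplex_apply_of_im_pos hz]
  have hcont0 : ContinuousAt 𝒴 0 :=
    (h𝒴.differentiableAt (Metric.ball_mem_nhds 0 one_pos)).continuousAt
  have hbd : IsBoundedAtImInfty F := by
    have ht : Tendsto F atImInfty (𝓝 (𝒴 0)) :=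
      hcont0.tendsto.comp (qParam_tendsto_atImInfty hH)
    exact ht.isBigO_one ℝ
  have hnice : Periodic (F ∘ ofComplex) H ∧ MDiff F ∧ IsBoundedAtImInfty F := ⟨hper, hmd, hbd⟩
  -- the cusp function is `𝒴` on the disc
  have hcusp : ∀ z ∈ Metric.ball (0 : ℂ) 1, cuspFunction H F z = 𝒴 z := by
    have hpunct : ∀ z ∈ Metric.ball (0 : ℂ) 1, z ≠ 0 → cuspFunction H F z = 𝒴 z := by
      intro z hz hz0
      have hpos : 0 < (Periodic.invQParam H z).im :=
        Periodic.im_invQParam_pos_of_norm_lt_one hH (mem_ball_zero_iff.mp hz) hz0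
      rw [cuspFunction, Periodic.cuspFunction_eq_of_nonzero _ _ hz0, comp_apply,
        ofComplex_apply_of_im_pos hpos]
      simp only [hFdef, Periodic.qParam_right_inv hH.ne' hz0]
    intro z hz
    by_cases hz0 : z = 0
    · subst hz0
      -- both sides are continuous at `0` and agree on a punctured neighbourhood
      have hc1 : ContinuousAt (cuspFunction H F) 0 :=
        (analyticAt_cuspFunction_zero hH hper hmd hbd).continuousAt
      have hev : cuspFunction H F =ᶠ[𝓝[≠] (0 : ℂ)] 𝒴 := by
        have h1 : ∀ᶠ z in 𝓝[≠] (0 : ℂ), z ∈ Metric.ball (0 : ℂ) 1 :=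
          eventually_nhdsWithin_of_eventually_nhds (Metric.ball_mem_nhds 0 one_pos)
        filter_upwards [h1, self_mem_nhdsWithin] with z hz hz0 using hpunct z hz hz0
      exact tendsto_nhds_unique (hc1.tendsto.mono_left nhdsWithin_le_nhds)
        ((hcont0.tendsto.mono_left nhdsWithin_le_nhds).congr' hev.symm)
    · exact hpunct z hz hz0
  refine ⟨hnice, hcusp, ?_⟩
  ext n
  rw [qExpansion_coeff, PowerSeries.coeff_mk]
  congr 1
  refine Filter.EventuallyEq.iteratedDeriv_eq n ?_
  filter_upwards [Metric.ball_mem_nhds (0 : ℂ) one_pos] with z hz using hcusp z hz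

/-! ### Orders of vanishing at `i∞` -/

/-- **A nice function whose first `N` coefficients vanish is `𝕢_Hᴺ` times a nice function**, with
the shifted expansion. [folklore] -/
theorem exists_eq_qParam_pow_mul_of_coeff_eq_zero {F : ℍ → ℂ} {H : ℝ} (hH : 0 < H)
    (hF : Periodic (F ∘ ofComplex) H ∧ MDiff F ∧ IsBoundedAtImInfty F) {N : ℕ}
    (h0 : ∀ k < N, (qExpansion H F).coeff k = 0) :
    ∃ G : ℍ → ℂ, (Periodic (G ∘ ofComplex) H ∧ MDiff G ∧ IsBoundedAtImInfty G) ∧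
      (∀ τ : ℍ, F τ = Periodic.qParam H τ ^ N * G τ) ∧
      qExpansion H F = PowerSeries.X ^ N * qExpansion H G := by
  -- on the disc: `cuspFunction H F = z^N 𝒢`
  have hcd := differentiableOn_cuspFunction_ball hH hF.1 hF.2.1 hF.2.2
  have h0' : ∀ k < N, PowerSeries.coeff k (PowerSeries.mk fun n ↦
      ((n ! : ℂ))⁻¹ * iteratedDeriv n (cuspFunction H F) 0) = 0 := fun k hk ↦ by
    rw [PowerSeries.coeff_mk]
    have := h0 k hk
    rwa [qExpansion_coeff] at this
  obtain ⟨𝒢, h𝒢d, hF𝒢, hT, -⟩ :=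
    Literature.Analysis.Complex.FormalRoot.exists_eq_pow_mul_of_coeff_eq_zero one_pos hcd h0'
  obtain ⟨hnice, -, hexp⟩ := nice_comp_qParam h𝒢d hH
  refine ⟨fun τ ↦ 𝒢 (Periodic.qParam H τ), hnice, fun τ ↦ ?_, ?_⟩
  · have hq : Periodic.qParam H (τ : ℂ) ∈ Metric.ball (0 : ℂ) 1 :=
      mem_ball_zero_iff.mpr (Periodic.norm_qParam_lt_one hH τ.im_pos)
    rw [← eq_cuspFunction τ hH.ne' hF.1, hF𝒢 _ hq]
  · rw [hexp]
    have : qExpansion H F = PowerSeries.mk fun n ↦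
        ((n ! : ℂ))⁻¹ * iteratedDeriv n (cuspFunction H F) 0 := by
      ext n; rw [qExpansion_coeff, PowerSeries.coeff_mk]
    rw [this, hT]

/-- **The limit at `i∞` of a nice function is its constant coefficient.** [folklore] -/
theorem tendsto_atImInfty_of_nice {F : ℍ → ℂ} {H : ℝ} (hH : 0 < H)
    (hF : Periodic (F ∘ ofComplex) H ∧ MDiff F ∧ IsBoundedAtImInfty F) :
    Tendsto F atImInfty (𝓝 ((qExpansion H F).coeff 0)) := by
  have han := analyticAt_cuspFunction_zero hH hF.1 hF.2.1 hF.2.2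
  rw [qExpansion_coeff_zero hH han hF.1, ← cuspFunction_apply_zero hH han hF.1]
  exact (han.continuousAt.tendsto.comp (qParam_tendsto_atImInfty hH)).congr
    fun τ ↦ eq_cuspFunction τ hH.ne' hF.1

/-- **Boundedness of a quotient at `i∞`**: if `F, G` are nice, `G ≠ 0` on `ℍ` and the constant
coefficient of `G` is non-zero, then `F / G` is bounded at `i∞`. [folklore] -/
theorem isBoundedAtImInfty_div_of_nice {F G : ℍ → ℂ} {H : ℝ} (hH : 0 < H)
    (hF : Periodic (F ∘ ofComplex) H ∧ MDiff F ∧ IsBoundedAtImInfty F)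
    (hG : Periodic (G ∘ ofComplex) H ∧ MDiff G ∧ IsBoundedAtImInfty G)
    (hG0 : (qExpansion H G).coeff 0 ≠ 0) :
    IsBoundedAtImInfty (fun τ ↦ F τ / G τ) := by
  have hGt := tendsto_atImInfty_of_nice hH hG
  have hinv : Tendsto (fun τ ↦ (G τ)⁻¹) atImInfty (𝓝 ((qExpansion H G).coeff 0)⁻¹) :=
    hGt.inv₀ hG0
  have hbdinv : IsBoundedAtImInfty (fun τ ↦ (G τ)⁻¹) := hinv.isBigO_one ℝ
  have : (fun τ ↦ F τ / G τ) = F * fun τ ↦ (G τ)⁻¹ := by funext τ; simp [div_eq_mul_inv]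
  rw [this]
  exact hF.2.2.mul hbdinv

end QExpansionAlgebra

end Literature.NumberTheory.ModularForms
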